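import Literature.AlgebraicGeometry.Frobenioids.PrimesMonoidIsoLeft
import HarnessLib

/-!
# Frobenioids I, Theorem 4.2 (iii): the RIGHT-HAND isomorphism `Φ₁(A)_𝔭 ≅ Φ₂(Ψ A)_{𝔭'}` induced by `Ψ`
# on the zero divisors of pre-steps OUT OF a Div-Frobenius-trivial object

Mochizuki, *The geometry of Frobenioids I: the general theory*, Kyushu J. Math. **62** (2008)
293–400, §4, Theorem 4.2 (iii), statement p. 78, proof p. 81 [cite: MochizukiFrdI2008, Thm. 4.2 (iii) p.78]:
"… isomorphisms of monoids `Φ₁(A₁)_𝔭₁ ≅ Φ₂(A₂)_𝔭₂` which we shall refer to, respectively, as the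
right-hand and left-hand isomorphisms induced by `Ψ`"; proof: the squares [`A_i → C_i` over `A_i → C_i'`]
"where the vertical morphisms are morphisms of Frobenius type, the morphisms `A_i → A_i` are Div-identity
endomorphisms, and the horizontal morphisms are primary steps" make the bijection compatible with `ℕ≥1`.

PROVED here (`exists_rightIso`), companion of `PrimesMonoidIsoLeft.lean` with the same HYPOTHESES
(Frobenioids of isotropic type, `Φ_i` perf-factorial; `Ψ`, `Ψ⁻¹` preserve pre-steps; `Ψ` preserves
morphisms of Frobenius type, Frobenius degrees and the Div-identity endomorphisms of `A` [Thm. 3.4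
(ii)(iii), Thm. 4.2 (i)]; `A` Div-Frobenius-trivial; primes `𝔭`, `𝔭'` corresponding as in clause (a) of
the typed `Thm42ii`): an isomorphism of monoids `r : Φ₁(A)_𝔭 ≃* Φ₂(Ψ A)_{𝔭'}` with
`r(Div φ) = Div(Ψ φ)` for every co-angular pre-step `φ` out of `A` with `Div φ ∈ Φ₁(A)_𝔭`. The square of
p. 81 out of `A` is built from Def. 1.3 (ii) (a Frobenius-type `β` of degree `n` out of the codomain, and
the essential uniqueness of Frobenius-type morphisms of degree `n` out of `A`) and Prop. 1.7 (ii)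
(`base-iso = pre-step ∘ Frobenius-type`); the monoid conclusion is the kernel
`IsMonoprime.nonempty_mulEquiv_of_dvd_iff_of_pow` (seat abc-iut-L1-d10). Composition is diagrammatic;
monoids multiplicative. No new definitions.
-/

namespace Literature.AlgebraicGeometry.Frobenioids

open CategoryTheory Opposite

namespace PreFrobenioid

universe w v v' u u' w₂ v₂ v₂' u₂ u₂'

variable {D : Type u} [Category.{v} D] {Φ : Dᵒᵖ ⥤ CommMonCat.{w}}
  {C : Type u'} [Category.{v'} C] {F : C ⥤ ElemFrobenioid Φ}

/-- **The square of p. 81 out of `A`, existence**: for a pre-step `φ : A → B` of a Frobenioid and a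
Frobenius-type endomorphism `α : A → A` of degree `n`, there are a morphism of Frobenius type
`β : B → B'` of degree `n` and a pre-step `φ' : A → B'` with `φ' ∘ α = β ∘ φ` (Def. 1.3 (ii): a
Frobenius-type `β` of degree `n` out of `B`, Prop. 1.7 (ii): `β ∘ φ = φ'' ∘ γ` with `γ` of Frobenius
type and `φ''` a pre-step, and the essential uniqueness of Frobenius-type morphisms of degree `n` out of
`A`). [cite: MochizukiFrdI2008, Thm. 4.2 (iii) p.81] -/
theorem exists_square_out (hF : IsFrobenioid F) {A B : C} {φ : A ⟶ B} (hφ : IsPreStep F φ)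
    {α : A ⟶ A} (hαf : IsFrobeniusType F α) :
    ∃ (B' : C) (β : B ⟶ B') (φ' : A ⟶ B'), IsFrobeniusType F β ∧ degFr F β = degFr F α ∧
      IsPreStep F φ' ∧ α ≫ φ' = φ ≫ β := by
  obtain ⟨B', β, hβ, hdegβ⟩ := hF.ii_exists B (degFr F α)
  have hbi : IsBaseIso F (φ ≫ β) := IsBaseIso.comp F hφ.2 hβ.2
  obtain ⟨X, γ, φ'', hfac, hγ, hφ''⟩ := (isBaseIso_iff_exists_frobeniusType_preStep F hF (φ ≫ β)).mp hbi
  have hdegγ : degFr F γ = degFr F α := by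
    have h := congrArg (degFr F) hfac
    rw [degFr_comp, degFr_comp, show degFr F φ'' = 1 from hφ''.1, show degFr F φ = 1 from hφ.1, mul_one,
      one_mul, hdegβ] at h
    exact h
  obtain ⟨b, hb⟩ := hF.ii_unique γ α hγ hαf hdegγ
  refine ⟨B', β, b.inv ≫ φ'', hβ, hdegβ, IsPreStep.comp F (isPreStep_of_isIso F _) hφ'', ?_⟩
  rw [← hb, Category.assoc, b.hom_inv_id_assoc, hfac]

variable {D₂ : Type u₂} [Category.{v₂} D₂] {Φ₂ : D₂ᵒᵖ ⥤ CommMonCat.{w₂}}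
  {C₂ : Type u₂'} [Category.{v₂'} C₂] {F₂ : C₂ ⥤ ElemFrobenioid Φ₂} (Ψ : C ≌ C₂)

set_option backward.isDefEq.respectTransparency false in
/-- **Theorem 4.2 (iii), the right-hand isomorphism** (FrdI p. 78, proof p. 81): under the hypotheses of
`exists_leftIso` and primes `𝔭` of `Φ₁(A)`, `𝔭'` of `Φ₂(Ψ A)` corresponding as in Thm. 4.2 (ii) (a)
[hypothesis `he`], there is an ISOMORPHISM OF MONOIDS `r : Φ₁(A)_𝔭 ≃* Φ₂(Ψ A)_{𝔭'}` with
`r(Div φ) = Div(Ψ φ)` for every co-angular pre-step `φ : A → B` with `Div φ ∈ Φ₁(A)_𝔭`.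
[cite: MochizukiFrdI2008, Thm. 4.2 (iii) p.78] -/
theorem exists_rightIso (hF : IsFrobenioid F) (hF₂ : IsFrobenioid F₂)
    (histr : IsOfIsotropicType F) (histr₂ : IsOfIsotropicType F₂)
    (hpf : Objectwise (fun M _ => IsPerfFactorial M) Φ)
    (hpf₂ : Objectwise (fun M _ => IsPerfFactorial M) Φ₂)
    (hpre : ∀ ⦃X Y : C⦄ (φ : X ⟶ Y), IsPreStep F φ → IsPreStep F₂ (Ψ.functor.map φ))
    (hpre' : ∀ ⦃X Y : C₂⦄ (φ : X ⟶ Y), IsPreStep F₂ φ → IsPreStep F (Ψ.inverse.map φ))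
    (hfrob : ∀ ⦃X Y : C⦄ (φ : X ⟶ Y), IsFrobeniusType F φ → IsFrobeniusType F₂ (Ψ.functor.map φ))
    (hdeg : ∀ ⦃X Y : C⦄ (φ : X ⟶ Y), degFr F₂ (Ψ.functor.map φ) = degFr F φ)
    {A : C} (hA : IsDivFrobeniusTrivial F A)
    (hdivid : ∀ α : A ⟶ A, IsDivIdentity F α → IsDivIdentity F₂ (Ψ.functor.map α))
    (𝔭 : Primes (Φ.obj (op (baseObj F A)))) (𝔭' : Primes (Φ₂.obj (op (baseObj F₂ (Ψ.functor.obj A)))))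
    (he : ∀ ⦃B : C⦄ (φ : A ⟶ B), IsCoAngularPreStep F φ →
      (Div F φ ∈ 𝔭.submonoid ↔ Div F₂ (Ψ.functor.map φ) ∈ 𝔭'.submonoid)) :
    ∃ r : 𝔭.submonoid ≃* 𝔭'.submonoid, ∀ ⦃B : C⦄ (φ : A ⟶ B), IsCoAngularPreStep F φ →
      ∀ h : Div F φ ∈ 𝔭.submonoid,
        (r ⟨Div F φ, h⟩ : Φ₂.obj (op (baseObj F₂ (Ψ.functor.obj A)))) = Div F₂ (Ψ.functor.map φ) := by
  have hP := hF.isPreFrobenioid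
  have hP₂ := hF₂.isPreFrobenioid
  have hco : ∀ {X Y : C} (f : X ⟶ Y), IsCoAngular F f :=
    fun f => isCoAngular_of_isIsotropic_codomains F f fun Z _ => histr Z
  -- a co-angular pre-step `φ_y : A → B_y` with `Div φ_y = y`, for every `y ∈ Φ₁(A)`
  choose Bo φo hφo hφox using fun y : Φ.obj (op (baseObj F A)) => hF.iii_d_under_surj A y
  let f : 𝔭.submonoid → 𝔭'.submonoid :=
    fun y => ⟨Div F₂ (Ψ.functor.map (φo y)), (he (φo y) (hφo y)).mp (by rw [hφox]; exact y.2)⟩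
  -- key: `f` computes `Div(Ψφ)` for EVERY pre-step `φ` out of `A` with `Div φ = y`
  have hkey : ∀ (y : 𝔭.submonoid) ⦃B : C⦄ (φ : A ⟶ B) (hφ : IsPreStep F φ), Div F φ = y →
      (f y : Φ₂.obj (op (baseObj F₂ (Ψ.functor.obj A)))) = Div F₂ (Ψ.functor.map φ) := by
    intro y B φ hφ hx
    exact (div_eq_iff_map Ψ hF hF₂ histr histr₂ hpre hpre' (hφo y).2 hφ).mp ((hφox y).trans hx.symm)
  -- compatible with `≤`
  have hdvd : ∀ x y : 𝔭.submonoid, x ∣ y ↔ f x ∣ f y := by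
    intro x y
    rw [Primes.subtype_dvd_iff, Primes.subtype_dvd_iff, ← hφox x, ← hφox y]
    exact div_dvd_iff_map Ψ hF hF₂ histr histr₂ hpre hpre' (hφo x).2 (hφo y).2
  -- compatible with `ℕ≥1`: the square through a Div-identity Frobenius endomorphism of `A`
  obtain ⟨ζ, hζ⟩ := hA
  have hζ' : ∀ n : ℕ+, ∃ α : A ⟶ A, degFr F α = n ∧ IsDivIdentity F α ∧ IsFrobeniusType F α :=
    fun n => ⟨ζ n, hζ n⟩
  have hpow : ∀ (y : 𝔭.submonoid) (n : ℕ+), f (y ^ (n : ℕ)) = f y ^ (n : ℕ) := by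
    intro y n
    obtain ⟨α, hdegα, hαd, hαf⟩ := hζ' n
    obtain ⟨B', β, φ', hβ, hdegβ, hφ', hsq⟩ := exists_square_out hF (hφo y).2 hαf
    -- in `C₁`: `Div φ' = y ^ n`
    have hx' : Div F φ' = (y : Φ.obj (op (baseObj F A))) ^ (n : ℕ) := by
      rw [div_eq_pow_of_square hαd hαf.1.2 hβ.1.2 hsq, hφox, hdegβ, hdegα]
    -- in `C₂`: the image square gives `Div(Ψφ') = Div(Ψφ_y) ^ n`
    have hsq₂ : Ψ.functor.map α ≫ Ψ.functor.map φ' = Ψ.functor.map (φo y) ≫ Ψ.functor.map β := by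
      rw [← Functor.map_comp, hsq, Functor.map_comp]
    have hx₂ := div_eq_pow_of_square (F := F₂) (hdivid _ hαd) (hfrob _ hαf).1.2 (hfrob _ hβ).1.2 hsq₂
    rw [hdeg, hdegβ, hdegα] at hx₂
    apply Subtype.ext
    rw [hkey (y ^ (n : ℕ)) φ' hφ' hx', hx₂]
    rfl
  -- bijective
  have hinj : Function.Injective f := by
    intro x y hxy
    have h1 : Div F₂ (Ψ.functor.map (φo x)) = Div F₂ (Ψ.functor.map (φo y)) := congrArg Subtype.val hxy
    have h2 := (div_eq_iff_map Ψ hF hF₂ histr histr₂ hpre hpre' (hφo x).2 (hφo y).2).mpr h1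
    exact Subtype.ext (by rw [← hφox x, ← hφox y, h2])
  have hsurj : Function.Surjective f := by
    intro z
    obtain ⟨Z, ξ, hξ, hξx⟩ := hF₂.iii_d_under_surj (Ψ.functor.obj A) z.1
    -- transport `ξ` back to a pre-step `ξ₁` out of `A`
    set ξ₁ : A ⟶ Ψ.inverse.obj Z := Ψ.unit.app A ≫ Ψ.inverse.map ξ with hξ₁def
    have hξ₁ : IsPreStep F ξ₁ := IsPreStep.comp F (isPreStep_of_isIso F _) (hpre' ξ hξ.2)
    have e1 : Ψ.functor.map ξ₁ = ξ ≫ Ψ.counitInv.app Z := by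
      rw [hξ₁def, Functor.map_comp, Ψ.fun_inv_map, ← Category.assoc, Ψ.functor_unit_comp,
        Category.id_comp]
    have hx₁ : Div F₂ (Ψ.functor.map ξ₁) = z.1 := by rw [e1, div_comp_iso hP₂, hξx]
    -- its divisor lies in `Φ₁(A)_𝔭` by (a) backwards
    have hy : Div F ξ₁ ∈ 𝔭.submonoid := (he ξ₁ ⟨hco _, hξ₁⟩).mpr (hx₁ ▸ z.2)
    refine ⟨⟨Div F ξ₁, hy⟩, Subtype.ext ?_⟩
    rw [hkey ⟨Div F ξ₁, hy⟩ ξ₁ hξ₁ rfl, hx₁]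
  -- the monoid kernel (seat abc-iut-L1-d10)
  obtain ⟨r, hr⟩ := IsMonoprime.nonempty_mulEquiv_of_dvd_iff_of_pow ((hpf _).isMonoprime 𝔭)
    ((hpf₂ _).isMonoprime 𝔭') (Equiv.ofBijective f ⟨hinj, hsurj⟩) hdvd hpow
  refine ⟨r, fun B φ hφ h => ?_⟩
  rw [hr, Equiv.ofBijective_apply, hkey ⟨Div F φ, h⟩ φ hφ.2 rfl]

end PreFrobenioid

end Literature.AlgebraicGeometry.Frobenioids
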